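import Summits.ResolutionOfSingularities.ResolutionOfSingularities.Theorems.StallVertexRigidClasses
import Summits.ResolutionOfSingularities.ResolutionOfSingularities.Theorems.StallVertexLineTurn
import HarnessLib

/-!
# StallVertexLetterClasses — decomp-res node «StallVertex» (lens-5 g20/g21 rev 6), add-on tree file 13 of the node

Content VERBATIM from the decomp-res lens-5 file `HOME/decomp-res-lens-5/g21/StallVertex.lean` rev 6 (pin 95ed6f6f,
3 344 l; rev 6 SUPERSEDES rev 5 5d7e6b95,
rev 4 74ef32c0 and rev 3 549891b7 as landing source — pure insertions, all earlier statements byte-identical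
(critic machine diffs); HOME = run/shared/lean/pub/decomp-res).
The rev-0/1/2 sections are ALREADY in the tree (`StallVertexForms` / `Kernels` / `Walk` / `Classes` / `Clean` /
`Rigid` / `Lines` / `RigidClasses` / `MaxContactCutStallVertex`,
writer g7); the add-on files carry ONLY the declarations NEW in rev 3 / 4 / 5 / 6.  Critic: CRITIC-LEDGER rows 142c
(rev 3: the old-letter law, CLEARED 2026-08-30T21:45:00Z),
142d (rev 4: the general carried-line law + line dichotomy, DECIDED +1, 22:09:45Z), 142e (rev 5: the turn law,
22:25:58Z), 142f (rev 6: THE EVENT-FREE LEAF IS EMPTY +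
THE MONOMIAL REGIME, DECIDED +1 for (S) as a whole, 22:52:49Z) — landing orders INBOX :362 / :396 / :429 (2) /
:471.  Landed by decomp-res writer g8 as `StallVertexCarry`
(§1d–§1e), `StallVertexOldLetter` (§1g + §3d–§3e), `StallVertexLineTurn` (§3f–§3g),
`StallVertexLetterClasses` (§4d–§4e classes and exact re-locations),
`StallVertexRegime` (§1i the monomial carry law + §3h a derivative is always carried / the monomial step),
`StallVertexStraightClasses` (§4f + §4g classes and exact
re-locations) and the wiring file `MaxContactCutStallVertexEvents` (every new `closes_…` /
`defectWalksDeep_iff_…` BY NAME on `MaxContactCut.DefectWalksDeep`).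
All `--supports stmt-ResolutionOfSingularities-31770`.  Every file of the node is in the Theses cone (the lens
imports the in-cone `DifferentialShade`), so the located
residual is booked on the route by RE-LOCATING the existing aside 28122 `CFNoSkewJointTailsDeep` to
`StallVertex.NoMonomialRegimeSkewStalledTailsDeep` (EXACT,
hypothesis-free chain skew ↔ vertexBound ↔ rigid ↔ lineFree ↔ letterFree ↔ eventFree ↔ straight ↔
monomialRegime: `skew_iff_monomialRegime`) — one aside on this
column, superseding the straight / event-free re-locations (critic row 142f: «file only the newest, exactly one
aside on this column; decided cells not filed»).

§4d (rev 3, `section Classes`) THE OLD-LETTER CELL `NoOldLetterCleanSkewStalledTailsDeep` DECIDED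
(`noOldLetterCleanSkewStalledTailsDeep_holds`) and the exact
re-location to the letter-free class `NoLetterFreeLineFreeSkewStalledTailsDeep` (`OldLetterAt`,
`letterFree_of_lineFree`, `lineFree_of_letterFree`, EXACT
`lineFree_iff_letterFree`, `skew_iff_letterFree`); §4e (rev 4) THE GENERAL-LINE CELL
`NoLineEventCleanSkewStalledTailsDeep` DECIDED
(`noLineEventCleanSkewStalledTailsDeep_holds`; `LineEventAt`, `YoungMonomialAt`, `lineEventAt_of_oldLetterAt`,
`line_dichotomy`) and the exact re-location to the
event-free class `NoEventFreeLineFreeSkewStalledTailsDeep` (`eventFree_of_lineFree`, `lineFree_of_eventFree`, EXACT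
`lineFree_iff_eventFree`, `letterFree_iff_eventFree`,
`skew_iff_eventFree`).  0 sorry.  The BY-NAME theorems on `MaxContactCut.DefectWalksDeep` are in
`MaxContactCutStallVertexEvents`.  Imports the landed
`StallVertexRigidClasses` and `StallVertexLineTurn`.

[WRITER NOTE (decomp-res writer g8): file split only; namespace, opens, section variables and every declaration
exactly as in the lens (global `set_option` dropped; the lens's `set_option maxHeartbeats … in` lines kept; the
lens's private copy `flat_monomial'` of the landed
`Literature.AlgebraicGeometry.Resolution.PointBlowup.flat_monomial` is dropped and cited by its full name).]

(Sources: KawanoueMatsuki2016 Prop. 4 (2), §4.1; Kawanoue2007 Lemma 2.2.1.2; BierstoneGrigorievMilmanWlodarczyk2011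
Def. 3.1.3; Hauser2010; HauserPerlega2024; Moh1987; CossartPiltant2008; Giraud1975; Hironaka1964; ZariskiSamuelII Ch. VIII §2.)
-/

noncomputable section

open MvPolynomial Finset
open Literature.AlgebraicGeometry.Resolution
open Literature.AlgebraicGeometry.Resolution.Hauser2010
open Literature.AlgebraicGeometry.Resolution.HauserPerlega2024
open Literature.Barriers.ResolutionOfSingularities
open Literature.AlgebraicGeometry.Resolution.PointBlowup
open Summit.ResolutionOfSingularities.ResolutionOfSingularities.Theses
open Summit.ResolutionOfSingularities.ResolutionOfSingularities.Theorems.TightDefectClasses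
open Summit.ResolutionOfSingularities.ResolutionOfSingularities.Theorems.ProximityCut
open Summit.ResolutionOfSingularities.ResolutionOfSingularities.Theorems.ExitLaw
open Summit.ResolutionOfSingularities.ResolutionOfSingularities.Theorems.DifferentialShade

namespace Summit.ResolutionOfSingularities.ResolutionOfSingularities.Theorems.StallVertex

section Classes

/-! ### §4d THE OLD-LETTER CELL (decided by the on-plane + carry laws) and the exact re-location of the line-free residual -/

/-- An OLD LETTER IN LINE POSITION at time `t`: some `μ_P`-minimiser's tangent cone is `r·u^s·(c₀u_m)^γ` with `γ > 0`
and `u_m` NOT a young exceptional coordinate (`m ∉ young`) — e.g. a pure power `(c₀u_m)^γ` of an old coordinate, the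
K–M «LGS element of level 1» read off the cone. [new object] -/
def OldLetterAt {K : Type} [Field K] [DecidableEq K] {q : ℕ} {s₀ : State (Fin 3) K} (W : ForcedWalk q s₀) (t : ℕ) : Prop :=
  ∃ J₀ ∈ (ifp W t).idx, (ifp W t).muP q = levelRatio (ordZero ((ifp W t).gen J₀)) (q - J₀.degree) ∧
    ∃ (m : Fin 3), m ∉ (ifp W t).young ∧ ∃ (s : Fin 3 →₀ ℕ) (r c₀ : K) (γ : ℕ), r ≠ 0 ∧ c₀ ≠ 0 ∧ 0 < γ ∧
      ordZero ((ifp W t).gen J₀) = ((s.degree + γ : ℕ) : ℕ∞) ∧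
      homogeneousComponent (s.degree + γ) ((ifp W t).gen J₀) = monomial s r * (C c₀ * X m) ^ γ

/-- DECIDED CLASS (d″): **OLD-LETTER CLEAN SKEW STALLED TAILS** — the line-free rigid skew stalled residual's binders
VERBATIM, plus: from some time `N₁ ≥ N` on every move is CLEAN for the minimisers (`CleanAt`, no interference) and at
some time `t₀ ≥ N₁` an OLD LETTER stands in line position in a minimiser's cone (`OldLetterAt`).  PROVED EMPTY below:
the on-plane law puts every later direction on `{u_m = 0}`, the carry law keeps the letter old and in line position,
so the walk never charts into `m` nor translates along it again — g19's planar letter — against the skew binder. -/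
def NoOldLetterCleanSkewStalledTailsDeep : Prop :=
  ∀ p : ℕ, p.Prime → ∀ e : ℕ, 2 ≤ e → ∀ (K : Type) [Field K] [CharP K p] [PerfectField K] [DecidableEq K]
    (s₀ : State (Fin 3) K), IsRoot (p ^ e) s₀ → ∀ W : ForcedWalk (p ^ e) s₀, (∀ i, 1 ≤ (W.st i).shade) →
    ∀ N : ℕ, (∀ t, N ≤ t → (W.st (t + 1)).shade = (W.st t).shade) →
    (∀ t, N ≤ t → ordZero (W.st t).F ≠ ((p ^ e : ℕ) : ℕ∞)) →
    (∀ M : ℕ, ∃ t, M ≤ t ∧ StaysOnNewest W t) → (∀ M : ℕ, ∃ t, M ≤ t ∧ W.b t ≠ 0) →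
    (∀ (k : Fin 3) (N' : ℕ), ∃ t, N' ≤ t ∧ (W.j t = k ∨ W.b t k ≠ 0)) →
    (∀ t, N ≤ t → (ifp W (t + 1)).muTilde (p ^ e) = (ifp W t).muTilde (p ^ e)) →
    (∀ t, N ≤ t → VertexLawEqAt W t) → (∀ t, N ≤ t → OriginLawAt W t) →
    (∀ (s : ℕ) (c : Fin 3 → K), ¬ ContactLineFrom W s c) →
    ∀ N₁ : ℕ, N ≤ N₁ → (∀ t, N₁ ≤ t → CleanAt W t) → ∀ t₀ : ℕ, N₁ ≤ t₀ → OldLetterAt W t₀ → False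

/-- **The old-letter cell is EMPTY** (kernel, every `q = p^e`, every field of characteristic `p`): `planar_of_oldLetter`
against the skew binder at the letter `m`. [folklore] -/
theorem noOldLetterCleanSkewStalledTailsDeep_holds : NoOldLetterCleanSkewStalledTailsDeep := by
  intro p hp e _ K _ _ _ _ s₀ hs W _ N _ _ _ _ hskew hstall _ _ _ N₁ hN₁ hcl t₀ ht₀ hold
  obtain ⟨J₀, hJ₀, hμ, m, hm, s, r, c₀, γ, hr, hc₀, hγ, hd₀, hG⟩ := hold
  have hplanar := planar_of_oldLetter hp hs W t₀ (fun t ht => hstall t (by omega)) (fun t ht => hcl t (by omega))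
    hJ₀ hμ hm s hr hc₀ hγ hd₀ hG
  obtain ⟨t, ht, hjt⟩ := hskew m t₀
  rcases hjt with hj | hb
  · exact (hplanar t ht).1 hj
  · exact hb (hplanar t ht).2

/-- LOCATED RESIDUAL after the old-letter cut: line-free rigid skew stalled tails that are EITHER unclean infinitely
often (INTERFERENCE i.o.) OR eventually clean WITHOUT an old letter in line position at any clean time (the cones of
the minimisers keep only young letters and non-coordinate lines: the binary-form / young-monomial regime). -/
def NoLetterFreeLineFreeSkewStalledTailsDeep : Prop :=
  ∀ p : ℕ, p.Prime → ∀ e : ℕ, 2 ≤ e → ∀ (K : Type) [Field K] [CharP K p] [PerfectField K] [DecidableEq K]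
    (s₀ : State (Fin 3) K), IsRoot (p ^ e) s₀ → ∀ W : ForcedWalk (p ^ e) s₀, (∀ i, 1 ≤ (W.st i).shade) →
    ∀ N : ℕ, (∀ t, N ≤ t → (W.st (t + 1)).shade = (W.st t).shade) →
    (∀ t, N ≤ t → ordZero (W.st t).F ≠ ((p ^ e : ℕ) : ℕ∞)) →
    (∀ M : ℕ, ∃ t, M ≤ t ∧ StaysOnNewest W t) → (∀ M : ℕ, ∃ t, M ≤ t ∧ W.b t ≠ 0) →
    (∀ (k : Fin 3) (N' : ℕ), ∃ t, N' ≤ t ∧ (W.j t = k ∨ W.b t k ≠ 0)) →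
    (∀ t, N ≤ t → (ifp W (t + 1)).muTilde (p ^ e) = (ifp W t).muTilde (p ^ e)) →
    (∀ t, N ≤ t → VertexLawEqAt W t) → (∀ t, N ≤ t → OriginLawAt W t) →
    (∀ (s : ℕ) (c : Fin 3 → K), ¬ ContactLineFrom W s c) →
    ((∀ N₁ : ℕ, N ≤ N₁ → ∃ t, N₁ ≤ t ∧ ¬ CleanAt W t) ∨
      (∃ N₁ : ℕ, N ≤ N₁ ∧ (∀ t, N₁ ≤ t → CleanAt W t) ∧ ∀ t₀, N₁ ≤ t₀ → ¬ OldLetterAt W t₀)) → False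

/-- Sub-class direction: the letter-free residual is implied by the line-free residual (binder dropped). [folklore] -/
theorem letterFree_of_lineFree (h : NoLineFreeRigidSkewStalledTailsDeep) : NoLetterFreeLineFreeSkewStalledTailsDeep :=
  fun p hp e he K _ _ _ _ s₀ hs W hsh N hplat hexc hS hT hskew hstall hrig horig hlf _ =>
    h p hp e he K s₀ hs W hsh N hplat hexc hS hT hskew hstall hrig horig hlf

/-- **EXACT RE-LOCATION**: line-free ⟸ letter-free, by the old-letter law (the dichotomy «unclean i.o. ∨ eventually
clean» and, on the clean side, «old letter at some clean time ∨ never»; the old-letter case is the empty cell).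
[folklore] -/
theorem lineFree_of_letterFree (h : NoLetterFreeLineFreeSkewStalledTailsDeep) : NoLineFreeRigidSkewStalledTailsDeep := by
  intro p hp e he K _ _ _ _ s₀ hs W hsh N hplat hexc hS hT hskew hstall hrig horig hlf
  refine h p hp e he K s₀ hs W hsh N hplat hexc hS hT hskew hstall hrig horig hlf ?_
  by_cases hclean : ∃ N₁ : ℕ, N ≤ N₁ ∧ ∀ t, N₁ ≤ t → CleanAt W t
  · obtain ⟨N₁, hN₁, hcl⟩ := hclean
    by_cases hold : ∃ t₀, N₁ ≤ t₀ ∧ OldLetterAt W t₀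
    · obtain ⟨t₀, ht₀, hol⟩ := hold
      exact (noOldLetterCleanSkewStalledTailsDeep_holds p hp e he K s₀ hs W hsh N hplat hexc hS hT hskew hstall hrig
        horig hlf N₁ hN₁ hcl t₀ ht₀ hol).elim
    · push Not at hold
      exact Or.inr ⟨N₁, hN₁, hcl, hold⟩
  · push Not at hclean
    refine Or.inl fun N₁ hN₁ => ?_
    obtain ⟨t, ht, hnc⟩ := hclean N₁ hN₁
    exact ⟨t, ht, hnc⟩

/-- `lineFree_iff_letterFree`: Auxiliary step of this node's calculus, VERBATIM from the lens file (see the module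
docstring); the statement is its type. [folklore] -/
theorem lineFree_iff_letterFree : NoLineFreeRigidSkewStalledTailsDeep ↔ NoLetterFreeLineFreeSkewStalledTailsDeep :=
  ⟨letterFree_of_lineFree, lineFree_of_letterFree⟩

/-- The g19 skew residual ⟺ the letter-free line-free residual (hypothesis-free: skew ↔ rigid ↔ line-free ↔
letter-free). [folklore] -/
theorem skew_iff_letterFree : CoefficientCut.NoSkewJointTailsDeep ↔ NoLetterFreeLineFreeSkewStalledTailsDeep :=
  skew_iff_lineFree.trans lineFree_iff_letterFree

/-! ### §4e THE GENERAL-LINE CELL (decided by the line step) and the exact re-location of the letter-free residual -/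

/-- A LINE EVENT at time `t`: some minimiser is in line shape `r·u^s·(Σcᵢuᵢ)^γ` (`γ > 0`) whose functional has two
nonzero coefficients or one at an old letter (`TwoOrOld`). An old-letter event is the special case `c = c₀·e_m`. [new] -/
def LineEventAt {K : Type} [Field K] [DecidableEq K] {q : ℕ} {s₀ : State (Fin 3) K} (W : ForcedWalk q s₀) (t : ℕ) : Prop :=
  ∃ (J₀ : Fin 3 →₀ ℕ) (s : Fin 3 →₀ ℕ) (r : K) (c : Fin 3 → K) (γ : ℕ), LineShape W t J₀ s r c γ ∧ TwoOrOld c (ifp W t).young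

/-- A YOUNG MONOMIAL at time `t`: some minimiser's tangent cone is a monomial `ρ·u^S` all of whose letters are YOUNG
exceptional coordinates — Kawanoue–Matsuki's MONOMIAL CASE read off the cone. [new] -/
def YoungMonomialAt {K : Type} [Field K] [DecidableEq K] {q : ℕ} {s₀ : State (Fin 3) K} (W : ForcedWalk q s₀) (t : ℕ) : Prop :=
  ∃ J₀ ∈ (ifp W t).idx, (ifp W t).muP q = levelRatio (ordZero ((ifp W t).gen J₀)) (q - J₀.degree) ∧
    ∃ (S : Fin 3 →₀ ℕ) (ρ : K), ρ ≠ 0 ∧ ordZero ((ifp W t).gen J₀) = ((S.degree : ℕ) : ℕ∞) ∧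
      homogeneousComponent S.degree ((ifp W t).gen J₀) = monomial S ρ ∧ ∀ i, S i ≠ 0 → i ∈ (ifp W t).young

/-- An old-letter event is a line event (`c = c₀·e_m`, old single letter). [folklore] -/
theorem lineEventAt_of_oldLetterAt {K : Type} [Field K] [DecidableEq K] {q : ℕ} {s₀ : State (Fin 3) K}
    (W : ForcedWalk q s₀) (t : ℕ) (h : OldLetterAt W t) : LineEventAt W t := by
  obtain ⟨J₀, hJ₀, hμ, m, hm, s, r, c₀, γ, hr, hc₀, hγ, hd₀, hG⟩ := h
  refine ⟨J₀, s, r, Pi.single m c₀, γ, ⟨hJ₀, hμ, hr, hγ, hd₀, by rw [sum_C_single_mul_X]; exact hG⟩,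
    Or.inr ⟨m, by rw [Pi.single_eq_same]; exact hc₀, hm⟩⟩

/-- **THE LINE DICHOTOMY (induction on the line step).**  On a stretch of stalled clean moves, a line event at `t₀`
with functional `c` leads to EXACTLY ONE of: the carried line is a CONTACT LINE FROM `t₀` (`ContactLineFrom W t₀ c`:
the functional never collapses onto a single young letter), or at some later time the carried functional has
collapsed and the cone shows an OLD LETTER in line position (`OldLetterAt`) or is a YOUNG MONOMIAL
(`YoungMonomialAt`). [folklore] -/
theorem line_dichotomy {K : Type} [Field K] [DecidableEq K] {p e : ℕ} (hp : p.Prime) [CharP K p]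
    {s₀ : State (Fin 3) K} (hs : IsRoot (p ^ e) s₀) (W : ForcedWalk (p ^ e) s₀) (t₀ : ℕ)
    (hst : ∀ t, t₀ ≤ t → (ifp W (t + 1)).muTilde (p ^ e) = (ifp W t).muTilde (p ^ e))
    (hcl : ∀ t, t₀ ≤ t → CleanAt W t)
    {J₀ : Fin 3 →₀ ℕ} {s : Fin 3 →₀ ℕ} {r : K} {c : Fin 3 → K} {γ : ℕ}
    (hL : LineShape W t₀ J₀ s r c γ) (h2 : TwoOrOld c (ifp W t₀).young) :
    ContactLineFrom W t₀ c ∨ ∃ t, t₀ < t ∧ (OldLetterAt W t ∨ YoungMonomialAt W t) := by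
  classical
  have key : ∀ n : ℕ, (∃ (s' : Fin 3 →₀ ℕ) (r' : K), LineShape W (t₀ + n) J₀ s' r' (carryLine W t₀ c n) γ ∧
      TwoOrOld (carryLine W t₀ c n) (ifp W (t₀ + n)).young) ∨
      ∃ t, t₀ < t ∧ (OldLetterAt W t ∨ YoungMonomialAt W t) := by
    intro n
    induction n with
    | zero => exact Or.inl ⟨s, r, hL, h2⟩
    | succ n ih =>
      rcases ih with ⟨s', r', hL', h2'⟩ | hesc
      · obtain ⟨_, hcb, s'', r'', hL''⟩ := line_step hp hs W (t₀ + n) (hst _ (Nat.le_add_right _ _))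
          (hcl _ (Nat.le_add_right _ _)) hL' h2'
        rw [← carryLine_succ] at hcb hL''
        by_cases h2'' : TwoOrOld (carryLine W t₀ c (n + 1)) (ifp W (t₀ + n + 1)).young
        · exact Or.inl ⟨s'', r'', hL'', h2''⟩
        · right
          -- COLLAPSE: the carried functional is a single YOUNG letter `m`
          obtain ⟨m, hm⟩ := hcb
          have hno : (∀ k k', k ≠ k' → carryLine W t₀ c (n + 1) k ≠ 0 → carryLine W t₀ c (n + 1) k' = 0) ∧
              ∀ k, carryLine W t₀ c (n + 1) k ≠ 0 → k ∈ (ifp W (t₀ + n + 1)).young := by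
            unfold TwoOrOld at h2''
            push Not at h2''
            exact h2''
          have hlin : (∑ i, C (carryLine W t₀ c (n + 1) i) * X i : MvPolynomial (Fin 3) K) =
              C (carryLine W t₀ c (n + 1) m) * X m := by
            rw [Finset.sum_eq_single m (fun k _ hk => by rw [hno.1 m k (Ne.symm hk) hm, C_0, zero_mul])
              (fun h => absurd (Finset.mem_univ _) h)]
          obtain ⟨hJ, hμ', hr', _, hd', hG'⟩ := hL''
          rw [hlin, monomial_mul_C_mul_X_pow] at hG'
          obtain ⟨S, hS⟩ : ∃ S : Fin 3 →₀ ℕ, S = s'' + Finsupp.single m γ := ⟨_, rfl⟩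
          have hSdeg : S.degree = s''.degree + γ := by rw [hS, map_add, Finsupp.degree_single]
          rw [← hS] at hG'
          rw [← hSdeg] at hd' hG'
          have hρ : r'' * carryLine W t₀ c (n + 1) m ^ γ ≠ 0 := mul_ne_zero hr' (pow_ne_zero _ hm)
          by_cases hold : ∃ m', S m' ≠ 0 ∧ m' ∉ (ifp W (t₀ + n + 1)).young
          · -- an OLD letter of the monomial: an old-letter event at `t₀ + n + 1`
            obtain ⟨m', hm'S, hm'y⟩ := hold
            have hSe : (S.erase m').degree + S m' = S.degree := by
              conv_rhs => rw [← Finsupp.erase_add_single m' S]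
              rw [map_add, Finsupp.degree_single]
            refine ⟨t₀ + n + 1, by omega, Or.inl ⟨J₀, hJ, hμ', m', hm'y, S.erase m', _, 1, S m', hρ, one_ne_zero,
              Nat.pos_of_ne_zero hm'S, by rw [hSe]; exact hd', ?_⟩⟩
            rw [hSe, hG', monomial_mul_C_mul_X_pow, one_pow, mul_one, Finsupp.erase_add_single]
          · -- all letters YOUNG: a young monomial at `t₀ + n + 1`
            push Not at hold
            exact ⟨t₀ + n + 1, by omega, Or.inr ⟨J₀, hJ, hμ', S, _, hρ, hd', hG', hold⟩⟩
      · exact Or.inr hesc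
  by_cases hesc : ∃ t, t₀ < t ∧ (OldLetterAt W t ∨ YoungMonomialAt W t)
  · exact Or.inr hesc
  · left
    have hkey : ∀ n, ∃ (s' : Fin 3 →₀ ℕ) (r' : K), LineShape W (t₀ + n) J₀ s' r' (carryLine W t₀ c n) γ ∧
        TwoOrOld (carryLine W t₀ c n) (ifp W (t₀ + n)).young := fun n => (key n).resolve_right hesc
    refine ⟨?_, fun n => ?_⟩
    · obtain ⟨k, hk⟩ : ∃ k, c k ≠ 0 := by
        rcases h2 with ⟨k, k', _, hk, _⟩ | ⟨k, hk, _⟩ <;> exact ⟨k, hk⟩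
      exact fun h0 => hk (by rw [h0]; rfl)
    · obtain ⟨s', r', hL', h2'⟩ := hkey n
      exact (line_step hp hs W (t₀ + n) (hst _ (Nat.le_add_right _ _)) (hcl _ (Nat.le_add_right _ _)) hL' h2').1

/-- DECIDED CLASS (e″): **LINE-EVENT CLEAN SKEW STALLED TAILS** — the line-free rigid skew stalled residual's binders
VERBATIM, plus: eventually clean from some `N₁ ≥ N`, NO young monomial at any time `≥ N₁`, and a LINE EVENT at some
`t₀ ≥ N₁`.  PROVED EMPTY below by the line dichotomy: a contact line contradicts the line-free binder, an old-letter
event falls in the (empty) old-letter cell, a young monomial contradicts the binder. -/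
def NoLineEventCleanSkewStalledTailsDeep : Prop :=
  ∀ p : ℕ, p.Prime → ∀ e : ℕ, 2 ≤ e → ∀ (K : Type) [Field K] [CharP K p] [PerfectField K] [DecidableEq K]
    (s₀ : State (Fin 3) K), IsRoot (p ^ e) s₀ → ∀ W : ForcedWalk (p ^ e) s₀, (∀ i, 1 ≤ (W.st i).shade) →
    ∀ N : ℕ, (∀ t, N ≤ t → (W.st (t + 1)).shade = (W.st t).shade) →
    (∀ t, N ≤ t → ordZero (W.st t).F ≠ ((p ^ e : ℕ) : ℕ∞)) →
    (∀ M : ℕ, ∃ t, M ≤ t ∧ StaysOnNewest W t) → (∀ M : ℕ, ∃ t, M ≤ t ∧ W.b t ≠ 0) →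
    (∀ (k : Fin 3) (N' : ℕ), ∃ t, N' ≤ t ∧ (W.j t = k ∨ W.b t k ≠ 0)) →
    (∀ t, N ≤ t → (ifp W (t + 1)).muTilde (p ^ e) = (ifp W t).muTilde (p ^ e)) →
    (∀ t, N ≤ t → VertexLawEqAt W t) → (∀ t, N ≤ t → OriginLawAt W t) →
    (∀ (s : ℕ) (c : Fin 3 → K), ¬ ContactLineFrom W s c) →
    ∀ N₁ : ℕ, N ≤ N₁ → (∀ t, N₁ ≤ t → CleanAt W t) → (∀ t, N₁ ≤ t → ¬ YoungMonomialAt W t) →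
    ∀ t₀ : ℕ, N₁ ≤ t₀ → LineEventAt W t₀ → False

/-- **The line-event cell is EMPTY** (kernel, every `q = p^e`, every field of characteristic `p`). [folklore] -/
theorem noLineEventCleanSkewStalledTailsDeep_holds : NoLineEventCleanSkewStalledTailsDeep := by
  intro p hp e he K _ _ _ _ s₀ hs W hsh N hplat hexc hS hT hskew hstall hrig horig hlf N₁ hN₁ hcl hnoY t₀ ht₀ hev
  obtain ⟨J₀, s, r, c, γ, hL, h2⟩ := hev
  rcases line_dichotomy hp hs W t₀ (fun t ht => hstall t (by omega)) (fun t ht => hcl t (by omega)) hL h2 with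
    hcontact | ⟨t, ht, hold | hyoung⟩
  · exact hlf t₀ c hcontact
  · exact noOldLetterCleanSkewStalledTailsDeep_holds p hp e he K s₀ hs W hsh N hplat hexc hS hT hskew hstall hrig horig
      hlf N₁ hN₁ hcl t (by omega) hold
  · exact hnoY t (by omega) hyoung

/-- LOCATED RESIDUAL after the line-event cut: line-free rigid skew stalled tails that are EITHER unclean infinitely
often (INTERFERENCE) OR eventually clean and then EITHER reach a YOUNG MONOMIAL cone (the monomial / turn regime) OR
never show a line event at all (every minimiser cone at every clean time is a non-line form: the SHAPE-LAW leaf). -/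
def NoEventFreeLineFreeSkewStalledTailsDeep : Prop :=
  ∀ p : ℕ, p.Prime → ∀ e : ℕ, 2 ≤ e → ∀ (K : Type) [Field K] [CharP K p] [PerfectField K] [DecidableEq K]
    (s₀ : State (Fin 3) K), IsRoot (p ^ e) s₀ → ∀ W : ForcedWalk (p ^ e) s₀, (∀ i, 1 ≤ (W.st i).shade) →
    ∀ N : ℕ, (∀ t, N ≤ t → (W.st (t + 1)).shade = (W.st t).shade) →
    (∀ t, N ≤ t → ordZero (W.st t).F ≠ ((p ^ e : ℕ) : ℕ∞)) →
    (∀ M : ℕ, ∃ t, M ≤ t ∧ StaysOnNewest W t) → (∀ M : ℕ, ∃ t, M ≤ t ∧ W.b t ≠ 0) →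
    (∀ (k : Fin 3) (N' : ℕ), ∃ t, N' ≤ t ∧ (W.j t = k ∨ W.b t k ≠ 0)) →
    (∀ t, N ≤ t → (ifp W (t + 1)).muTilde (p ^ e) = (ifp W t).muTilde (p ^ e)) →
    (∀ t, N ≤ t → VertexLawEqAt W t) → (∀ t, N ≤ t → OriginLawAt W t) →
    (∀ (s : ℕ) (c : Fin 3 → K), ¬ ContactLineFrom W s c) →
    ((∀ N₁ : ℕ, N ≤ N₁ → ∃ t, N₁ ≤ t ∧ ¬ CleanAt W t) ∨
      (∃ N₁ : ℕ, N ≤ N₁ ∧ (∀ t, N₁ ≤ t → CleanAt W t) ∧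
        ((∃ t, N₁ ≤ t ∧ YoungMonomialAt W t) ∨ (∀ t₀, N₁ ≤ t₀ → ¬ LineEventAt W t₀)))) → False

/-- Sub-class direction: the event-free residual is implied by the line-free residual (binder dropped). [folklore] -/
theorem eventFree_of_lineFree (h : NoLineFreeRigidSkewStalledTailsDeep) : NoEventFreeLineFreeSkewStalledTailsDeep :=
  fun p hp e he K _ _ _ _ s₀ hs W hsh N hplat hexc hS hT hskew hstall hrig horig hlf _ =>
    h p hp e he K s₀ hs W hsh N hplat hexc hS hT hskew hstall hrig horig hlf

/-- **EXACT RE-LOCATION**: line-free ⟸ event-free, by the line dichotomy (through the line-event cell). [folklore] -/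
theorem lineFree_of_eventFree (h : NoEventFreeLineFreeSkewStalledTailsDeep) : NoLineFreeRigidSkewStalledTailsDeep := by
  intro p hp e he K _ _ _ _ s₀ hs W hsh N hplat hexc hS hT hskew hstall hrig horig hlf
  refine h p hp e he K s₀ hs W hsh N hplat hexc hS hT hskew hstall hrig horig hlf ?_
  by_cases hclean : ∃ N₁ : ℕ, N ≤ N₁ ∧ ∀ t, N₁ ≤ t → CleanAt W t
  · obtain ⟨N₁, hN₁, hcl⟩ := hclean
    by_cases hy : ∃ t, N₁ ≤ t ∧ YoungMonomialAt W t
    · exact Or.inr ⟨N₁, hN₁, hcl, Or.inl hy⟩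
    · push Not at hy
      by_cases hev : ∃ t₀, N₁ ≤ t₀ ∧ LineEventAt W t₀
      · obtain ⟨t₀, ht₀, hev⟩ := hev
        exact (noLineEventCleanSkewStalledTailsDeep_holds p hp e he K s₀ hs W hsh N hplat hexc hS hT hskew hstall hrig
          horig hlf N₁ hN₁ hcl hy t₀ ht₀ hev).elim
      · push Not at hev
        exact Or.inr ⟨N₁, hN₁, hcl, Or.inr hev⟩
  · push Not at hclean
    refine Or.inl fun N₁ hN₁ => ?_
    obtain ⟨t, ht, hnc⟩ := hclean N₁ hN₁
    exact ⟨t, ht, hnc⟩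

/-- `lineFree_iff_eventFree`: Auxiliary step of this node's calculus, VERBATIM from the lens file (see the module
docstring); the statement is its type. [folklore] -/
theorem lineFree_iff_eventFree : NoLineFreeRigidSkewStalledTailsDeep ↔ NoEventFreeLineFreeSkewStalledTailsDeep :=
  ⟨eventFree_of_lineFree, lineFree_of_eventFree⟩

/-- The rev-3 letter-free residual, too, IS the event-free residual (all located residuals are exactly equivalent).
[folklore] -/
theorem letterFree_iff_eventFree : NoLetterFreeLineFreeSkewStalledTailsDeep ↔ NoEventFreeLineFreeSkewStalledTailsDeep :=
  lineFree_iff_letterFree.symm.trans lineFree_iff_eventFree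

/-- The g19 skew residual ⟺ the event-free residual (hypothesis-free). [folklore] -/
theorem skew_iff_eventFree : CoefficientCut.NoSkewJointTailsDeep ↔ NoEventFreeLineFreeSkewStalledTailsDeep :=
  skew_iff_lineFree.trans lineFree_iff_eventFree

end Classes

end Summit.ResolutionOfSingularities.ResolutionOfSingularities.Theorems.StallVertex
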